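import Summits.Ventures.HodgeRepro2.A2PlaneMonomials

/-!
# The main part of the coproduct of a plane-sorted monomial (A2 annex, operator identity — part 4)

For a plane-sorted monomial `P = ∏_{p ∈ L} m_p` (`A2PlaneMonomials.planeProd`), p5's coproduct
`Δ = cop` (the pull-back `m^*` along the addition of the model) satisfies

  `Δ(P) ≡ Σ_{S ⊆ E(P)} P∖S ⊗ E_S   (mod K)`,

where `E(P)` is the set of planes of `L` carrying the factor `E_p`, `P∖S` is `P` with those factors
removed (`eraseS`), and `K = WeilPairing.K Q ∅` is p5's span of the tensors `x ⊗ y` whose right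
factor `y` is a *half-plane* monomial (one generator of some plane `q ∈ Q`, the rest outside `q`).
The proof is an induction on `L` through `Δ(E_p) = E_p ⊗ 1 + a_p ⊗ b_p − b_p ⊗ a_p + 1 ⊗ E_p`
(`cop_E`) and `Δ(a_p) = a_p ⊗ 1 + 1 ⊗ a_p` (`cop_gen`): the cross terms have half-plane right
factors.  Against `II (inl z * inr θ^r * ·)` the half-plane terms vanish
(`II_pair_K_empty_eq_zero`) and the main part is evaluated by p5's `integral_theta_pow_mul_ET`
(`II_pair_cop_planeProd`).
-/

namespace Summit.Ventures.HodgeRepro2.A2CoproductMain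

open WeilPlanes WeilIntegral WeilDetect WeilCoproduct WeilPairing A2PlaneMonomials

variable {ι : Type*} [DecidableEq ι]

/-! ## Half-plane tensors: p5's `K Q ∅` -/

/-- A tensor whose right factor is a half-plane monomial of a plane `q ∈ Q` lies in `K Q ∅`. -/
lemma tmul_half_mem_K {Q : Finset ι} {q : ι} (hq : q ∈ Q) (c : Bool) {l : List (Gen ι)}
    (hl : ∀ j ∈ l, j.1 ≠ q) (x : A ι) : x ᵍ⊗ₜ[ℂ] (gen (q, c) * mono l) ∈ K Q ∅ :=
  tmul_mem_K x (Or.inl ⟨q, hq, c, l, hl, rfl⟩)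

omit [DecidableEq ι] in
/-- `E_T` is a monomial avoiding every plane outside `T`. -/
lemma forall_mem_planeList_ne {T : Finset ι} {q : ι} (hq : q ∉ T) :
    ∀ j ∈ planeList T, j.1 ≠ q := fun _ hj h =>
  hq (h ▸ mem_planeList.1 hj)

/-- `inr (gen (q, c)) * (x ⊗ E_T) ∈ K Q ∅` for `q ∈ Q`, `q ∉ T`. -/
lemma inr_gen_mul_tmul_ET_mem_K {Q T : Finset ι} {q : ι} (hq : q ∈ Q) (hqT : q ∉ T) (c : Bool)
    (x : A ι) : inr (gen (q, c)) * x ᵍ⊗ₜ[ℂ] ET T ∈ K Q ∅ := by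
  refine Submodule.span_le.2 ?_ (inr_gen_mul_tmul_mem (q, c) x (ET T))
  rintro _ ⟨x', rfl⟩
  rw [ET_eq_mono]
  exact tmul_half_mem_K hq c (forall_mem_planeList_ne hqT) x'

/-- Left multiplication by `inr (E p)`, `p ∉ Q`, preserves `K Q ∅`. -/
lemma inr_E_mul_mem_K_empty {Q : Finset ι} {p : ι} (hp : p ∉ Q) {Z : AA ι} (hZ : Z ∈ K Q ∅) :
    inr (E p) * Z ∈ K Q ∅ := by
  induction hZ using Submodule.span_induction with
  | mem Z hZ =>
    obtain ⟨x, y, hy, rfl⟩ := hZ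
    rw [inr_E_mul_tmul]
    rcases hy with ⟨q, hq, c, l, hl, rfl⟩ | ⟨T', hT', _⟩
    · rw [← mul_assoc, (commute_E p (gen (q, c))).eq, mul_assoc, E_eq_mono, ← mono_append]
      refine tmul_half_mem_K hq c ?_ x
      intro j hj
      rcases List.mem_append.1 hj with h | h
      · have hpq : p ≠ q := fun h' => hp (h' ▸ hq)
        simp only [List.mem_cons, List.not_mem_nil, or_false] at h
        rcases h with rfl | rfl <;> exact hpq
      · exact hl j h
    · exact absurd hT' (Finset.not_ssubset_empty T')
  | zero => simp
  | add Z Z' _ _ hZ hZ' => rw [mul_add]; exact Submodule.add_mem _ hZ hZ'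
  | smul r Z _ hZ => rw [mul_smul_comm]; exact Submodule.smul_mem _ r hZ

/-- Left multiplication by `cop (E p)`, `p ∉ Q`, maps `K Q ∅` into `K (insert p Q) ∅`. -/
lemma cop_E_mul_mem_K_empty {Q : Finset ι} {p : ι} (hp : p ∉ Q) {Z : AA ι} (hZ : Z ∈ K Q ∅) :
    cop (E p) * Z ∈ K (insert p Q) ∅ := by
  have hQ : K Q ∅ ≤ K (insert p Q) ∅ := K_mono (Finset.subset_insert p Q) (le_refl _)
  rw [cop_E]
  simp only [add_mul, sub_mul, mul_assoc]
  refine Submodule.add_mem _ (hQ (inr_E_mul_mem_K_empty hp hZ)) (Submodule.sub_mem _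
    (Submodule.add_mem _ (hQ (inl_mul_mem_K _ hZ)) ?_) ?_)
  · exact inl_mul_mem_K _ (inr_gen_mul_mem_K (Finset.empty_subset _) hp _ hZ)
  · exact inl_mul_mem_K _ (inr_gen_mul_mem_K (Finset.empty_subset _) hp _ hZ)

/-- Left multiplication by `cop (pf p m)`, `p ∉ Q`, maps `K Q ∅` into `K (insert p Q) ∅`. -/
lemma cop_pf_mul_mem_K_empty {Q : Finset ι} {p : ι} (hp : p ∉ Q) (m : Bool × Bool) {Z : AA ι}
    (hZ : Z ∈ K Q ∅) : cop (pf p m) * Z ∈ K (insert p Q) ∅ := by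
  have hQ : K Q ∅ ≤ K (insert p Q) ∅ := K_mono (Finset.subset_insert p Q) (le_refl _)
  rcases m with ⟨s, t⟩
  cases s <;> cases t
  · rw [pf_ff, map_one, one_mul]; exact hQ hZ
  · rw [pf_ft]; exact cop_gen_mul_mem_K (Finset.empty_subset _) hp _ hZ
  · rw [pf_tf]; exact cop_gen_mul_mem_K (Finset.empty_subset _) hp _ hZ
  · rw [pf_tt]; exact cop_E_mul_mem_K_empty hp hZ

/-! ## The main part -/

/-- The planes of `L` carrying the factor `E_p` in `planeProd L m`. -/
def Eplanes (L : List ι) (m : ι → Bool × Bool) : Finset ι :=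
  L.toFinset.filter fun p => m p = (true, true)

/-- Membership in `Eplanes`. -/
lemma mem_Eplanes {L : List ι} {m : ι → Bool × Bool} {p : ι} :
    p ∈ Eplanes L m ↔ p ∈ L ∧ m p = (true, true) := by
  simp [Eplanes]

/-- `Eplanes` over `q :: L`. -/
lemma Eplanes_cons (q : ι) (L : List ι) (m : ι → Bool × Bool) :
    Eplanes (q :: L) m = if m q = (true, true) then insert q (Eplanes L m) else Eplanes L m := by
  simp only [Eplanes, List.toFinset_cons, Finset.filter_insert]

/-- The main part of `cop (planeProd L m)`: `Σ_{S ⊆ Eplanes L m} planeProd L (m ∖ S) ⊗ E_S`. -/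
noncomputable def mainPart (L : List ι) (m : ι → Bool × Bool) : AA ι :=
  ∑ S ∈ (Eplanes L m).powerset, planeProd L (eraseS m S) ᵍ⊗ₜ[ℂ] ET S

/-- `E_∅ = 1`. -/
lemma ET_empty : ET (∅ : Finset ι) = 1 := by
  simp [ET]

/-- The main part over no planes is `1 ⊗ 1 = 1`. -/
lemma mainPart_nil (m : ι → Bool × Bool) : mainPart [] m = 1 := by
  simp [mainPart, Eplanes, one_eq_tmul_one]

/-- The data `eraseS m S` agree with `m` at a plane outside `S`; used for `q ∉ L`, `S ⊆ L`. -/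
lemma eraseS_apply_of_subset {L : List ι} {q : ι} (hq : q ∉ L) {S : Finset ι}
    (hS : S ⊆ L.toFinset) (m : ι → Bool × Bool) : eraseS m S q = m q :=
  eraseS_apply_of_notMem m fun h => hq (List.mem_toFinset.1 (hS h))

/-- A plane-sorted monomial over `q :: L` with data erased along `S ⊆ L`, `q ∉ L`, is
`pf q (m q)` times the monomial over `L`. -/
lemma planeProd_cons_eraseS {L : List ι} {q : ι} (hq : q ∉ L) {S : Finset ι}
    (hS : S ⊆ L.toFinset) (m : ι → Bool × Bool) :
    planeProd (q :: L) (eraseS m S) = pf q (m q) * planeProd L (eraseS m S) := by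
  rw [planeProd_cons, eraseS_apply_of_subset hq hS]

/-- The main part over `q :: L`, `q ∉ L`, when `q` does not carry `E_q`: `inl (pf q (m q))` times
the main part over `L`. -/
lemma mainPart_cons_of_ne {L : List ι} {q : ι} (hq : q ∉ L) {m : ι → Bool × Bool}
    (hm : m q ≠ (true, true)) : mainPart (q :: L) m = inl (pf q (m q)) * mainPart L m := by
  simp only [mainPart, Eplanes_cons, if_neg hm, Finset.mul_sum]
  refine Finset.sum_congr rfl fun S hS => ?_
  have hS' : S ⊆ L.toFinset :=
    (Finset.mem_powerset.1 hS).trans (Finset.filter_subset _ _)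
  rw [planeProd_cons_eraseS hq hS', inl_mul_tmul]

/-- The main part over `q :: L`, `q ∉ L`, when `q` carries `E_q`: `(inl (E q) + inr (E q))` times
the main part over `L`. -/
lemma mainPart_cons_of_eq {L : List ι} {q : ι} (hq : q ∉ L) {m : ι → Bool × Bool}
    (hm : m q = (true, true)) :
    mainPart (q :: L) m = (inl (E q) + inr (E q)) * mainPart L m := by
  have hqE : q ∉ Eplanes L m := fun h => hq (mem_Eplanes.1 h).1
  rw [mainPart, Eplanes_cons, if_pos hm,
    Finset.sum_powerset_insert hqE (fun S => planeProd (q :: L) (eraseS m S) ᵍ⊗ₜ[ℂ] ET S),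
    add_mul, mainPart, Finset.mul_sum, Finset.mul_sum]
  congr 1
  · refine Finset.sum_congr rfl fun S hS => ?_
    have hS' : S ⊆ L.toFinset :=
      (Finset.mem_powerset.1 hS).trans (Finset.filter_subset _ _)
    rw [planeProd_cons_eraseS hq hS', hm, pf_tt, inl_mul_tmul]
  · refine Finset.sum_congr rfl fun S hS => ?_
    have hS' : S ⊆ L.toFinset :=
      (Finset.mem_powerset.1 hS).trans (Finset.filter_subset _ _)
    have hqS : q ∉ S := fun h => hq (List.mem_toFinset.1 (hS' h))
    rw [planeProd_cons, eraseS_apply_of_mem m (Finset.mem_insert_self q S), pf_ff, one_mul,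
      eraseS_insert, planeProd_update_of_notMem hq, ET_insert hqS, inr_E_mul_tmul]

/-- **The coproduct of a plane-sorted monomial is its main part modulo half-plane tensors**:
`cop (planeProd L m) − mainPart L m ∈ K L.toFinset ∅` for a list `L` of distinct planes. -/
theorem cop_planeProd_sub_mainPart_mem {L : List ι} (hL : L.Nodup) (m : ι → Bool × Bool) :
    cop (planeProd L m) - mainPart L m ∈ K L.toFinset ∅ := by
  induction L with
  | nil => simp [mainPart_nil]
  | cons q L ih =>
    have hqL : q ∉ L := (List.nodup_cons.1 hL).1
    have hL' : L.Nodup := (List.nodup_cons.1 hL).2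
    have hqQ : q ∉ L.toFinset := fun h => hqL (List.mem_toFinset.1 h)
    have hQ : K L.toFinset ∅ ≤ K (q :: L).toFinset ∅ := by
      rw [List.toFinset_cons]
      exact K_mono (Finset.subset_insert q _) (le_refl _)
    have hκ : cop (pf q (m q)) * (cop (planeProd L m) - mainPart L m) ∈ K (q :: L).toFinset ∅ := by
      rw [List.toFinset_cons]
      exact cop_pf_mul_mem_K_empty hqQ (m q) (ih hL')
    have hsplit : cop (planeProd (q :: L) m) - mainPart (q :: L) m =
        (cop (pf q (m q)) * mainPart L m - mainPart (q :: L) m) +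
          cop (pf q (m q)) * (cop (planeProd L m) - mainPart L m) := by
      rw [planeProd_cons, map_mul, mul_sub]
      abel
    rw [hsplit]
    refine Submodule.add_mem _ ?_ hκ
    by_cases hm : m q = (true, true)
    · rw [mainPart_cons_of_eq hqL hm, hm, pf_tt, cop_E, List.toFinset_cons]
      have : (inr (E q) + (inl (E q) + inl (gen (q, false)) * inr (gen (q, true)) -
          inl (gen (q, true)) * inr (gen (q, false)))) * mainPart L m -
          (inl (E q) + inr (E q)) * mainPart L m =
          inl (gen (q, false)) * (inr (gen (q, true)) * mainPart L m) -
            inl (gen (q, true)) * (inr (gen (q, false)) * mainPart L m) := by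
        simp only [add_mul, sub_mul, mul_assoc]
        abel
      rw [this]
      refine Submodule.sub_mem _ (inl_mul_mem_K _ ?_) (inl_mul_mem_K _ ?_)
      · simp only [mainPart, Finset.mul_sum]
        refine Submodule.sum_mem _ fun S hS => ?_
        have hqS : q ∉ S := fun h =>
          hqL ((mem_Eplanes.1 ((Finset.mem_powerset.1 hS) h)).1)
        exact inr_gen_mul_tmul_ET_mem_K (Finset.mem_insert_self q _) hqS _ _
      · simp only [mainPart, Finset.mul_sum]
        refine Submodule.sum_mem _ fun S hS => ?_
        have hqS : q ∉ S := fun h =>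
          hqL ((mem_Eplanes.1 ((Finset.mem_powerset.1 hS) h)).1)
        exact inr_gen_mul_tmul_ET_mem_K (Finset.mem_insert_self q _) hqS _ _
    · rw [mainPart_cons_of_ne hqL hm, List.toFinset_cons]
      rcases hmq : m q with ⟨s, t⟩
      have hR : ∀ c : Bool, inr (gen (q, c)) * mainPart L m ∈ K (insert q L.toFinset) ∅ := by
        intro c
        simp only [mainPart, Finset.mul_sum]
        refine Submodule.sum_mem _ fun S hS => ?_
        have hqS : q ∉ S := fun h =>
          hqL ((mem_Eplanes.1 ((Finset.mem_powerset.1 hS) h)).1)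
        exact inr_gen_mul_tmul_ET_mem_K (Finset.mem_insert_self q _) hqS _ _
      rw [hmq] at hm
      cases s <;> cases t
      · simp
      · rw [pf_ft, cop_gen, add_mul, add_sub_cancel_left]; exact hR true
      · rw [pf_tf, cop_gen, add_mul, add_sub_cancel_left]; exact hR false
      · exact absurd rfl hm

/-! ## Pairing against `inl z * inr θ^r` -/

variable [Fintype ι]

/-- Half-plane tensors are killed by the pairing `II (inl z * inr θ^r * ·)`: the integral of
`θ^r` times a half-plane monomial vanishes (p5's `integral_theta_pow_mul_mono_eq_zero_of_half`). -/
theorem II_pair_K_empty_eq_zero (Q : Finset ι) (z : A ι) (c : ι → ℂ) (r : ℕ) {Z : AA ι}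
    (hZ : Z ∈ K Q ∅) : II (inl z * inr (theta c ^ r) * Z) = 0 := by
  induction hZ using Submodule.span_induction with
  | mem Z hZ =>
    obtain ⟨x, y, hy, rfl⟩ := hZ
    rcases hy with ⟨q, _, b, l, hl, rfl⟩ | ⟨T', hT', _⟩
    · rw [II_pair_tmul]
      have hmono : gen (q, b) * mono l = mono ((q, b) :: l) := by simp [mono]
      rw [hmono, integral_theta_pow_mul_mono_eq_zero_of_half c r (List.mem_cons_self ..), mul_zero]
      intro h
      rcases List.mem_cons.1 h with h | h
      · exact Bool.not_ne_self b (Prod.mk.inj h).2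
      · exact hl _ h rfl
    · exact absurd hT' (Finset.not_ssubset_empty T')
  | zero => simp
  | add Z Z' _ _ hZ hZ' => rw [mul_add, map_add, hZ, hZ', add_zero]
  | smul r Z _ hZ => rw [mul_smul_comm, map_smul, hZ, smul_zero]

/-- The pairing of the main part: `Σ_{S ⊆ Eplanes L m} ∫_B z ∧ P∖S · ∫_B θ^r ∧ E_S`, the second
factor being `r! c_{S^c} vol` when `|S^c| = r` and `0` otherwise. -/
theorem II_pair_mainPart (L : List ι) (m : ι → Bool × Bool) (z : A ι) (c : ι → ℂ) (r : ℕ) :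
    II (inl z * inr (theta c ^ r) * mainPart L m) =
      ∑ S ∈ (Eplanes L m).powerset, integral (z * planeProd L (eraseS m S)) *
        (if (Finset.univ \ S).card = r then
          ((r.factorial : ℂ) * ∏ p ∈ Finset.univ \ S, c p) * vol ι else 0) := by
  simp only [mainPart, Finset.mul_sum, map_sum, II_pair_tmul, integral_theta_pow_mul_ET]

/-- **The pairing of the coproduct of a plane-sorted monomial**: only the main part contributes. -/
theorem II_pair_cop_planeProd {L : List ι} (hL : L.Nodup) (m : ι → Bool × Bool) (z : A ι)
    (c : ι → ℂ) (r : ℕ) :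
    II (inl z * inr (theta c ^ r) * cop (planeProd L m)) =
      ∑ S ∈ (Eplanes L m).powerset, integral (z * planeProd L (eraseS m S)) *
        (if (Finset.univ \ S).card = r then
          ((r.factorial : ℂ) * ∏ p ∈ Finset.univ \ S, c p) * vol ι else 0) := by
  have h := II_pair_K_empty_eq_zero L.toFinset z c r (cop_planeProd_sub_mainPart_mem hL m)
  rw [mul_sub, map_sub, sub_eq_zero] at h
  rw [h, II_pair_mainPart]

end Summit.Ventures.HodgeRepro2.A2CoproductMain
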